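import Summits.CriticalPhenomena.SAWScalingLimit.Theorems.SAWLoopFugacityFlowAvoidanceLimitRingTwoSided
import Summits.CriticalPhenomena.SAWScalingLimit.Theorems.SAWLoopFugacityFlowAvoidanceLimitLateralOneSided
import Summits.CriticalPhenomena.SAWScalingLimit.Theorems.SAWLoopFugacityFlowAvoidanceLimitNestedGermArcs
import Summits.CriticalPhenomena.SAWScalingLimit.Theorems.SAWLoopFugacityFlowAvoidanceLimitWalkNearCurve
import Summits.CriticalPhenomena.SAWScalingLimit.Theorems.SAWLoopFugacityFlowAvoidanceLimitHubIVT
import Literature.Probability.LatticeModels.KilledWalkPotential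
import Mathlib.Topology.MetricSpace.Thickening
import HarnessLib

/-!
# Existence of the two-sided hub in the middle ring of the germ region

Sub-problem `CriticalPhenomena/SAWScalingLimit`, crux `AvoidanceLimit`, line `symplectic-fermion-anchor`
(lead c7), stub `stub_germTwoSided`, HUB EXISTENCE (crux NOTES.md §"hcore blueprint (lead c6)" §7),
from the landed bricks `ring_twoSided` (two-sidedness `h_T + h_B ≥ 1 - ε` in the middle ring),
`lateral_oneSided` (`h_X ≥ 1 - ε` near an interior point of the lateral arc `α_X`), `exists_walk_near_curve`
(a kept lattice walk along a compact curve of `D`), `exists_hub_vertex_zd` (the intermediate-value argument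
along a walk for two nonnegative killed-superharmonic functions) and the three-scale nesting of the germ arcs
(hypothesis `h3`, = the registered stub `threeScale_germArcs`): there is a universal ratio `Λ` such that for
scales `Λ³ s ≤ s'` and nested germ arcs `σ' < θ₁ < θ₂ < τ'` of `(s, s')`, for some `ρ > 0` and all small
`δ`, some site `z` of `Θ' = germSites D b s' g o δ`, not in `Θ(s)`, in the middle ring
`Λ s ≤ |δz - b|∞`, `Λ |δz - b|∞ ≤ s'`, at distance `≥ ρ` from `∂D`, has both lateral side potentials
`h_T(z) = killedPotential Ω^δ Θ' (sideSrc Ω^δ D δ (D.boundary '' [σ', θ₁])) z ≥ 1/10` and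
`h_B(z) ≥ 1/10` (`α_B = D.boundary '' [θ₂, τ']`). (With the separation `Λ² s ≤ s'` only, the ring
`Λ s ≤ |δz - b|∞ ≤ s'/Λ` may degenerate to a single square, which generically contains no mesh point; the
cube leaves room for a square of radius `t = 2 Λ s` and a collar of width `Λ s / 2` about it inside the ring.)

Proof: `Λ = Λ₀ + 2` with `Λ₀` the ring constant of `ring_twoSided (1/2)`; intermediate scale `t = 2 Λ s`
(TwoOff there by `twoOff_boxJD`: a gate end of the outer gate is a point of `∂D` off the closed `t`-box); the
intermediate gate `germGate D b t g o` runs from the interior of `α_T` to the interior of `α_B` (`h3`) and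
lies in `U' = germRegion(s')` (`germGate_subset_germRegion`) and off `closure U(s)`
(`not_mem_closure_germRegion_of_mem_gateArc`); a compact sub-arc `κ` of it with ends within `ρ_T/2`,
`ρ_B/2` of the two gate ends (`exists_curve_near_ends`) has uniform margins inside `D`, inside `U'` and off
`closure U(s)` (`IsCompact.exists_thickening_subset_open`); the lattice walk along `κ`
(`exists_walk_near_curve`, tolerance below all margins and below `Λ s / 2`) consists of sites of
`Θ' ∖ Θ(s)` in the ring `[3Λs/2, 5Λs/2] ∋ |δz - b|∞` (`sup_norm_near_square`), macroscopically inside `D`,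
starts where `h_T ≥ 9/10` and ends where `h_B ≥ 9/10` (`lateral_oneSided (1/10)`), carries
`h_T + h_B ≥ 1/2` (`ring_twoSided (1/2)`), and `exists_hub_vertex_zd` (with `η = 1/2`) picks the hub on it.

[cite: Chelkak2016, Lemma 3.4 and Proposition 3.3]
-/

noncomputable section

open scoped BigOperators Classical Topology
open Set Metric Filter
open Literature.Topology.PlaneTopology
open Literature.Probability.LatticeModels
open Literature.Probability.RandomPlanarGeometry (JordanDomain)

namespace Summit.CriticalPhenomena.SAWScalingLimit.Theorems.AvoidanceLimit.Anchor

/-! ### Continuum geometry -/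

/-- A convex combination of two points of an open interval lies in the interval. [folklore] -/
theorem add_mul_sub_mem_Ioo {lo hi a c θ : ℝ} (ha : a ∈ Ioo lo hi) (hc : c ∈ Ioo lo hi)
    (hθ : θ ∈ Icc (0 : ℝ) 1) : a + θ * (c - a) ∈ Ioo lo hi := by
  rcases le_total a c with hac | hac
  · have h1 : 0 ≤ θ * (c - a) := mul_nonneg hθ.1 (by linarith)
    have h2 : θ * (c - a) ≤ 1 * (c - a) := mul_le_mul_of_nonneg_right hθ.2 (by linarith)
    exact ⟨by linarith [ha.1], by linarith [hc.2]⟩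
  · have h1 : θ * (c - a) ≤ 0 := mul_nonpos_of_nonneg_of_nonpos hθ.1 (by linarith)
    have h2 : 1 * (c - a) ≤ θ * (c - a) := mul_le_mul_of_nonpos_right hθ.2 (by linarith)
    exact ⟨by linarith [hc.1], by linarith [ha.2]⟩

/-- **An oriented sub-arc of an open arc, near its two ends.** For a continuous `f : ℝ → ℂ`, `lo < hi`,
two points `P₁, P₂` which are the two ends `f lo`, `f hi` in some order, and radii `r₁, r₂ > 0`, there is
a continuous curve `γ` with `γ([0, 1]) ⊆ f '' (lo, hi)`, `γ 0` within `r₁` of `P₁` and `γ 1` within `r₂`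
of `P₂` (parameters close to the two ends by continuity, affine parametrisation, reversed if needed).
[folklore] -/
theorem exists_curve_near_ends {f : ℝ → ℂ} (hf : Continuous f) {lo hi : ℝ} (hlh : lo < hi)
    {P₁ P₂ : ℂ} (hP : ({P₁, P₂} : Set ℂ) = {f lo, f hi}) {r₁ r₂ : ℝ} (hr₁ : 0 < r₁) (hr₂ : 0 < r₂) :
    ∃ γ : ℝ → ℂ, Continuous γ ∧ (∀ θ ∈ Icc (0 : ℝ) 1, γ θ ∈ f '' Ioo lo hi) ∧
      dist (γ 0) P₁ < r₁ ∧ dist (γ 1) P₂ < r₂ := by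
  have hr : 0 < min r₁ r₂ := lt_min hr₁ hr₂
  -- parameters close to the two ends
  obtain ⟨u₁, hu₁, hd₁⟩ : ∃ u₁ ∈ Ioo lo hi, dist (f u₁) (f lo) < min r₁ r₂ := by
    obtain ⟨Δ, hΔ, h⟩ := Metric.continuousAt_iff.1 hf.continuousAt _ hr
    have hlo : lo < min (lo + Δ / 2) ((lo + hi) / 2) := lt_min (by linarith) (by linarith)
    refine ⟨min (lo + Δ / 2) ((lo + hi) / 2), ⟨hlo, (min_le_right _ _).trans_lt (by linarith)⟩, h ?_⟩
    rw [Real.dist_eq, abs_of_pos (sub_pos.2 hlo)]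
    linarith [min_le_left (lo + Δ / 2) ((lo + hi) / 2)]
  obtain ⟨u₂, hu₂, hd₂⟩ : ∃ u₂ ∈ Ioo lo hi, dist (f u₂) (f hi) < min r₁ r₂ := by
    obtain ⟨Δ, hΔ, h⟩ := Metric.continuousAt_iff.1 hf.continuousAt _ hr
    have hhi : max (hi - Δ / 2) ((lo + hi) / 2) < hi := max_lt (by linarith) (by linarith)
    refine ⟨max (hi - Δ / 2) ((lo + hi) / 2), ⟨lt_of_lt_of_le (by linarith) (le_max_right _ _), hhi⟩, h ?_⟩
    rw [Real.dist_eq, abs_of_neg (sub_neg.2 hhi)]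
    linarith [le_max_left (hi - Δ / 2) ((lo + hi) / 2)]
  rcases Set.pair_eq_pair_iff.1 hP with ⟨h1, h2⟩ | ⟨h1, h2⟩
  · refine ⟨fun θ => f (u₁ + θ * (u₂ - u₁)), by fun_prop,
      fun θ hθ => ⟨_, add_mul_sub_mem_Ioo hu₁ hu₂ hθ, rfl⟩, ?_, ?_⟩
    · rw [h1]; simpa using hd₁.trans_le (min_le_left _ _)
    · rw [h2]; simpa using hd₂.trans_le (min_le_right _ _)
  · refine ⟨fun θ => f (u₂ + θ * (u₁ - u₂)), by fun_prop,
      fun θ hθ => ⟨_, add_mul_sub_mem_Ioo hu₂ hu₁ hθ, rfl⟩, ?_, ?_⟩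
    · rw [h1]; simpa using hd₂.trans_le (min_le_left _ _)
    · rw [h2]; simpa using hd₁.trans_le (min_le_right _ _)

/-- **Uniform margin of a compact set in an open set**: some `r > 0` such that every point within `r`
of the compact set lies in the open set (`IsCompact.exists_thickening_subset_open`). [folklore] -/
theorem exists_margin {K U : Set ℂ} (hK : IsCompact K) (hU : IsOpen U) (hKU : K ⊆ U) :
    ∃ r : ℝ, 0 < r ∧ ∀ p ∈ K, ∀ x : ℂ, dist x p < r → x ∈ U := by
  obtain ⟨r, hr, hsub⟩ := hK.exists_thickening_subset_open hU hKU
  exact ⟨r, hr, fun p hp x hx => hsub (Metric.mem_thickening_iff.2 ⟨p, hp, hx⟩)⟩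

/-- **Macroscopic distance from the frontier**: if every point within `r` of `K` lies in the open set
`D`, then a point within `r/2` of `K` is at distance `≥ r/2` from the (nonempty) frontier of `D`.
[folklore] -/
theorem le_infDist_frontier_of_margin {K D : Set ℂ} {r : ℝ} (hfr : (frontier D).Nonempty)
    (hD : IsOpen D) (hm : ∀ p ∈ K, ∀ x : ℂ, dist x p < r → x ∈ D) {p : ℂ} (hp : p ∈ K) {x : ℂ}
    (hx : dist x p < r / 2) : r / 2 ≤ infDist x (frontier D) := by
  rw [Metric.le_infDist hfr]
  intro y hy
  by_contra hlt
  push Not at hlt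
  have hyD : y ∈ D := hm p hp y (by
    calc dist y p ≤ dist y x + dist x p := dist_triangle _ _ _
      _ < r / 2 + r / 2 := by rw [dist_comm]; exact add_lt_add hlt hx
      _ = r := by ring)
  have hmem : y ∈ D ∩ frontier D := ⟨hyD, hy⟩
  rw [hD.inter_frontier_eq] at hmem
  exact hmem

/-- **Sup-norm position of a point near the square of radius `t`.** If `p` lies on the square
`closedBox b t ∖ box b t` and `dist x p < ε`, then `t - ε ≤ |x - b|∞ ≤ t + ε`. [folklore] -/
theorem sup_norm_near_square {b p x : ℂ} {t ε : ℝ}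
    (hp : p ∈ closedBox b t \ Literature.Topology.PlaneTopology.box b t) (hx : dist x p < ε) :
    t - ε ≤ max |x.re - b.re| |x.im - b.im| ∧ max |x.re - b.re| |x.im - b.im| ≤ t + ε := by
  rw [dist_eq_norm] at hx
  have hre : |x.re - p.re| < ε := by
    have h := Complex.abs_re_le_norm (x - p); rw [Complex.sub_re] at h; exact h.trans_lt hx
  have him : |x.im - p.im| < ε := by
    have h := Complex.abs_im_le_norm (x - p); rw [Complex.sub_im] at h; exact h.trans_lt hx
  obtain ⟨hp1, hp2⟩ := hp
  rw [mem_closedBox] at hp1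
  rw [Literature.Topology.PlaneTopology.mem_box] at hp2
  rw [abs_lt] at hre him
  constructor
  · by_contra hcon
    push Not at hcon
    rw [max_lt_iff, abs_lt, abs_lt] at hcon
    obtain ⟨⟨h1, h2⟩, h3, h4⟩ := hcon
    exact hp2 ⟨by linarith, by linarith, by linarith, by linarith⟩
  · rw [max_le_iff, abs_le, abs_le]
    obtain ⟨k1, k2, k3, k4⟩ := hp1
    exact ⟨⟨by linarith, by linarith⟩, by linarith, by linarith⟩

/-- **The inner germ gate lies in the outer germ region** (scales `t < s'`, base point `g` in the
small box, far point `o` off the big closed box): the inner gate lies in `D` and in the closure of the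
inner germ region `U(t) ⊆ U(s')`, and `D ∩ closure U(s') = U(s') ∪ germGate(s')`
(`carrier_inter_frontier_germRegion`), while the two gates lie on different squares. [folklore] -/
theorem germGate_subset_germRegion {D : JordanDomain} {b : ℂ} {t s' : ℝ} (ht : 0 < t) (hs' : 0 < s')
    (hts' : t < s') (h2t : TwoOff D (boxJD b ht)) (h2' : TwoOff D (boxJD b hs')) {g o : ℂ}
    (hg : g ∈ D.carrier ∩ Literature.Topology.PlaneTopology.box b t) (ho : o ∈ D.carrier)
    (hoc : o ∉ closedBox b s') : germGate D b ht g o ⊆ germRegion D b hs' g o := by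
  intro q hq
  have hg' : g ∈ D.carrier ∩ Literature.Topology.PlaneTopology.box b s' :=
    ⟨hg.1, Literature.Topology.PlaneTopology.box_mono hts'.le hg.2⟩
  have hoct : o ∉ closedBox b t := fun h => hoc (closedBox_mono hts'.le h)
  have hqD : q ∈ D.carrier := gate_subset_carrier _ hq
  have hqcl : q ∈ closure (germRegion D b hs' g o) :=
    closure_mono (germRegion_mono ht hts' h2t h2' hg ho hoc)
      (germGate_subset_closure_germRegion h2t hg ho hoct hq)
  by_contra hqU
  have hqfr : q ∈ frontier (germRegion D b hs' g o) :=
    ⟨hqcl, by rw [(isOpen_germRegion h2' hg' ho hoc).interior_eq]; exact hqU⟩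
  have hqS' : q ∈ germGate D b hs' g o := by
    rw [← carrier_inter_frontier_germRegion h2' hg' ho hoc]; exact ⟨hqD, hqfr⟩
  have h1 := germGate_subset_square (hs := ht) (g := g) (o := o) hq
  have h1' := germGate_subset_square (hs := hs') (g := g) (o := o) hqS'
  exact h1'.2 (closedBox_subset_box hts' h1.1)

/-! ### The hub -/

/-- **Existence of the two-sided hub** (modulo the three-scale nesting of germ arcs `h3`). See the
module docstring. [cite: Chelkak2016, Lemma 3.4] -/
theorem germHub_of_threeScale :
    (∀ (D : JordanDomain) (b : ℂ) (s t s' : ℝ) (hs : 0 < s) (ht : 0 < t) (hs' : 0 < s'), s < t → t < s' →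
      ∀ (g o : ℂ), TwoOff D (boxJD b hs) → TwoOff D (boxJD b ht) → TwoOff D (boxJD b hs') →
        g ∈ D.carrier ∩ Literature.Topology.PlaneTopology.box b s → o ∈ D.carrier → o ∉ closedBox b s' →
      ∀ (σ' θ₁ θ₂ τ' : ℝ), σ' < θ₁ → θ₁ < θ₂ → θ₂ < τ' → τ' < σ' + 1 →
        frontier (germRegion D b hs' g o) =
          gateArc D (boxJD b hs') (germGateParam D b hs' g o) ∪ D.boundary '' Set.Icc σ' τ' →
        frontier (germRegion D b hs g o) =
          gateArc D (boxJD b hs) (germGateParam D b hs g o) ∪ D.boundary '' Set.Icc θ₁ θ₂ →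
        ({D.boundary θ₁, D.boundary θ₂} : Set ℂ) =
          {(boxJD b hs).boundary (gateLo D (boxJD b hs) (germGateParam D b hs g o)),
           (boxJD b hs).boundary (gateHi D (boxJD b hs) (germGateParam D b hs g o))} →
        ({D.boundary σ', D.boundary τ'} : Set ℂ) =
          {(boxJD b hs').boundary (gateLo D (boxJD b hs') (germGateParam D b hs' g o)),
           (boxJD b hs').boundary (gateHi D (boxJD b hs') (germGateParam D b hs' g o))} →
      ∃ φ₁ φ₂ : ℝ, σ' < φ₁ ∧ φ₁ < θ₁ ∧ θ₂ < φ₂ ∧ φ₂ < τ' ∧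
        frontier (germRegion D b ht g o) =
          gateArc D (boxJD b ht) (germGateParam D b ht g o) ∪ D.boundary '' Set.Icc φ₁ φ₂ ∧
        ({D.boundary φ₁, D.boundary φ₂} : Set ℂ) =
          {(boxJD b ht).boundary (gateLo D (boxJD b ht) (germGateParam D b ht g o)),
           (boxJD b ht).boundary (gateHi D (boxJD b ht) (germGateParam D b ht g o))}) →
    ∃ Λ : ℝ, 1 < Λ ∧ ∀ (D : JordanDomain), ∀ b ∈ frontier D.carrier, ∀ (s s' : ℝ) (hs : 0 < s) (hs' : 0 < s'),
      Λ ^ 3 * s ≤ s' →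
    ∀ (g o : ℂ), TwoOff D (boxJD b hs) → TwoOff D (boxJD b hs') →
      g ∈ D.carrier ∩ Literature.Topology.PlaneTopology.box b s → o ∈ D.carrier → o ∉ closedBox b s' →
    ∀ (σ' θ₁ θ₂ τ' : ℝ), σ' < θ₁ → θ₁ < θ₂ → θ₂ < τ' → τ' < σ' + 1 →
      frontier (germRegion D b hs' g o) =
        gateArc D (boxJD b hs') (germGateParam D b hs' g o) ∪ D.boundary '' Set.Icc σ' τ' →
      frontier (germRegion D b hs g o) =
        gateArc D (boxJD b hs) (germGateParam D b hs g o) ∪ D.boundary '' Set.Icc θ₁ θ₂ →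
      ({D.boundary θ₁, D.boundary θ₂} : Set ℂ) =
        {(boxJD b hs).boundary (gateLo D (boxJD b hs) (germGateParam D b hs g o)),
         (boxJD b hs).boundary (gateHi D (boxJD b hs) (germGateParam D b hs g o))} →
      ({D.boundary σ', D.boundary τ'} : Set ℂ) =
        {(boxJD b hs').boundary (gateLo D (boxJD b hs') (germGateParam D b hs' g o)),
         (boxJD b hs').boundary (gateHi D (boxJD b hs') (germGateParam D b hs' g o))} →
    ∃ ρ : ℝ, 0 < ρ ∧ ∀ᶠ δ in 𝓝[>] (0 : ℝ), ∃ z ∈ germSites D b hs' g o δ, z ∉ germSites D b hs g o δ ∧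
      Λ * s ≤ max |(meshPoint δ z).re - b.re| |(meshPoint δ z).im - b.im| ∧
      Λ * max |(meshPoint δ z).re - b.re| |(meshPoint δ z).im - b.im| ≤ s' ∧
      ρ ≤ Metric.infDist (meshPoint δ z) (frontier D.carrier) ∧
      1 / 10 ≤ killedPotential (discreteDomainGraph D.carrier δ) (germSites D b hs' g o δ)
        (sideSrc (discreteDomainGraph D.carrier δ) D.carrier δ (D.boundary '' Set.Icc σ' θ₁)) z ∧
      1 / 10 ≤ killedPotential (discreteDomainGraph D.carrier δ) (germSites D b hs' g o δ)
        (sideSrc (discreteDomainGraph D.carrier δ) D.carrier δ (D.boundary '' Set.Icc θ₂ τ')) z := by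
  intro h3
  -- (0) the constants: `Λ₀` of the ring estimate at tolerance `1/2`, `Λ = Λ₀ + 2`
  obtain ⟨Λ₀, hΛ₀, hR⟩ := ring_twoSided (1 / 2) (by norm_num)
  refine ⟨Λ₀ + 2, by linarith, ?_⟩
  intro D b hb s s' hs hs' hΛ g o h2 h2' hg ho hoc σ' θ₁ θ₂ τ' hσθ hθθ hθτ hτσ hfU' hfU hends hends'
  set Λ : ℝ := Λ₀ + 2 with hΛ_def
  have hΛ3 : (3 : ℝ) < Λ := by rw [hΛ_def]; linarith
  have hΛpos : (0 : ℝ) < Λ := by linarith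
  have hΛ₀Λ : Λ₀ ≤ Λ := by rw [hΛ_def]; linarith
  have hΛcube : 2 * Λ < Λ ^ 3 := by
    have h9 : (9 : ℝ) < Λ ^ 2 := by nlinarith
    nlinarith
  -- the intermediate scale `t = 2 Λ s`
  obtain ⟨t, ht_def⟩ : ∃ t : ℝ, t = 2 * Λ * s := ⟨_, rfl⟩
  have ht : 0 < t := by rw [ht_def]; positivity
  have hst : s < t := by rw [ht_def]; nlinarith
  have hts' : t < s' := by
    rw [ht_def]
    have : 2 * Λ * s < Λ ^ 3 * s := by nlinarith
    linarith
  have hss' : s < s' := hst.trans hts'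
  have hg' : g ∈ D.carrier ∩ Literature.Topology.PlaneTopology.box b s' :=
    ⟨hg.1, Literature.Topology.PlaneTopology.box_mono hss'.le hg.2⟩
  have hgt : g ∈ D.carrier ∩ Literature.Topology.PlaneTopology.box b t :=
    ⟨hg.1, Literature.Topology.PlaneTopology.box_mono hst.le hg.2⟩
  have hoct : o ∉ closedBox b t := fun h => hoc (closedBox_mono hts'.le h)
  -- (1) two points of the `t`-square off `D`: a gate end of the outer gate is a point of `∂D` off the
  -- closed `t`-box
  have hpar' := (germGateParam_spec h2' hg' ho hoc).1
  have h2t : TwoOff D (boxJD b ht) := by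
    refine twoOff_boxJD D ht hb fun hsub => ?_
    have hP := boundary_gateLo_mem_frontier h2' hpar'
    exact (boundary_boxJD_mem b hs' _).2 (closedBox_subset_box hts' (hsub hP))
  -- (2) the intermediate boundary arcs
  obtain ⟨φ₁, φ₂, hσφ₁, hφ₁θ₁, hθ₂φ₂, hφ₂τ', -, hendst⟩ :=
    h3 D b s t s' hs ht hs' hst hts' g o h2 h2t h2' hg ho hoc σ' θ₁ θ₂ τ' hσθ hθθ hθτ hτσ hfU' hfU
      hends hends'
  -- (3) the endpoint estimates near the two ends of the intermediate gate
  have hστ' : σ' < τ' := by linarith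
  obtain ⟨ρT, hρT, hT⟩ := lateral_oneSided (1 / 10) (by norm_num) D b s' hs' g o h2' hg' ho hoc σ' τ'
    hστ' hτσ hfU' hends' σ' θ₁ φ₁ le_rfl (by linarith) hσφ₁ hφ₁θ₁
  obtain ⟨ρB, hρB, hB⟩ := lateral_oneSided (1 / 10) (by norm_num) D b s' hs' g o h2' hg' ho hoc σ' τ'
    hστ' hτσ hfU' hends' θ₂ τ' φ₂ (by linarith) le_rfl hθ₂φ₂ hφ₂τ'
  -- (4) the transversal: a compact sub-arc of the intermediate gate near its two ends
  have hpt : germGateParam D b ht g o ∈ gateParams D (boxJD b ht) := (germGateParam_spec h2t hgt ho hoct).1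
  have hlohi : gateLo D (boxJD b ht) (germGateParam D b ht g o) <
      gateHi D (boxJD b ht) (germGateParam D b ht g o) := (gateLo_lt h2t hpt).trans (lt_gateHi h2t hpt)
  obtain ⟨γ, hγc, hγS, hγ0, hγ1⟩ :=
    exists_curve_near_ends (boxJD b ht).continuous_boundary hlohi hendst (half_pos hρT) (half_pos hρB)
  have hγgate : ∀ θ ∈ Icc (0 : ℝ) 1, γ θ ∈ germGate D b ht g o := hγS
  set K : Set ℂ := γ '' Icc 0 1 with hK_def
  have hK : IsCompact K := isCompact_Icc.image hγc
  have hKgate : K ⊆ germGate D b ht g o := by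
    rintro _ ⟨θ, hθ, rfl⟩; exact hγgate θ hθ
  have hKD : K ⊆ D.carrier := fun p hp => gate_subset_carrier _ (hKgate hp)
  have hKU' : K ⊆ germRegion D b hs' g o :=
    hKgate.trans (germGate_subset_germRegion ht hs' hts' h2t h2' hgt ho hoc)
  have hKcl : K ⊆ (closure (germRegion D b hs g o))ᶜ := fun p hp =>
    not_mem_closure_germRegion_of_mem_gateArc hs ht hst h2 h2t hg ho hoct
      (gate_subset_gateArc _ (hKgate hp))
  have hKsq : K ⊆ closedBox b t \ Literature.Topology.PlaneTopology.box b t := by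
    rintro _ ⟨θ, hθ, rfl⟩
    obtain ⟨u, -, hu⟩ := hγS θ hθ
    rw [← hu]
    exact boundary_boxJD_mem b ht u
  -- (5) uniform margins of the sub-arc: inside `D`, inside `U'`, off `closure U(s)`
  obtain ⟨r₁, hr₁, hm₁⟩ := exists_margin hK D.isOpen hKD
  obtain ⟨r₂, hr₂, hm₂⟩ := exists_margin hK (isOpen_germRegion h2' hg' ho hoc) hKU'
  obtain ⟨r₃, hr₃, hm₃⟩ := exists_margin hK isClosed_closure.isOpen_compl hKcl
  -- the tolerance of the lattice walk
  obtain ⟨ε, hε, hε₁, hε₂, hε₃, hε₄, hε₅, hε₆⟩ : ∃ ε : ℝ, 0 < ε ∧ ε ≤ r₁ / 2 ∧ ε ≤ r₂ ∧ ε ≤ r₃ ∧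
      ε ≤ Λ * s / 2 ∧ ε ≤ ρT / 2 ∧ ε ≤ ρB / 2 := by
    have hΛs : 0 < Λ * s / 2 := by positivity
    refine ⟨min (min (min (r₁ / 2) r₂) (min r₃ (Λ * s / 2))) (min (ρT / 2) (ρB / 2)),
      lt_min (lt_min (lt_min (half_pos hr₁) hr₂) (lt_min hr₃ hΛs)) (lt_min (half_pos hρT) (half_pos hρB)),
      ?_, ?_, ?_, ?_, ?_, ?_⟩
    · exact (min_le_left _ _).trans ((min_le_left _ _).trans (min_le_left _ _))
    · exact (min_le_left _ _).trans ((min_le_left _ _).trans (min_le_right _ _))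
    · exact (min_le_left _ _).trans ((min_le_right _ _).trans (min_le_left _ _))
    · exact (min_le_left _ _).trans ((min_le_right _ _).trans (min_le_right _ _))
    · exact (min_le_right _ _).trans (min_le_left _ _)
    · exact (min_le_right _ _).trans (min_le_right _ _)
  have hW := exists_walk_near_curve D γ hγc.continuousOn (fun θ hθ => hKD ⟨θ, hθ, rfl⟩) ε hε
  have hRδ := hR D b hb s s' hs hs' hss' g o h2 h2' hg ho hoc σ' θ₁ θ₂ τ' hσθ hθθ hθτ hτσ hfU' hfU hends
  -- (6) the hub, eventually in `δ`
  refine ⟨r₁ / 2, half_pos hr₁, ?_⟩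
  filter_upwards [hRδ, hT, hB, hW] with δ hRδ hTδ hBδ hWδ
  obtain ⟨u, v, π, hu, hv, hsupp⟩ := hWδ
  -- every site of the walk is admissible
  have hsite : ∀ z ∈ π.support, z ∈ germSites D b hs' g o δ ∧ z ∉ germSites D b hs g o δ ∧
      t - ε ≤ max |(meshPoint δ z).re - b.re| |(meshPoint δ z).im - b.im| ∧
      max |(meshPoint δ z).re - b.re| |(meshPoint δ z).im - b.im| ≤ t + ε ∧
      r₁ / 2 ≤ infDist (meshPoint δ z) (frontier D.carrier) := by
    intro z hz
    obtain ⟨hzm, θ, hθ, hdz⟩ := hsupp z hz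
    have hpK : γ θ ∈ K := ⟨θ, hθ, rfl⟩
    have hring := sup_norm_near_square (hKsq hpK) hdz
    refine ⟨⟨hzm, hm₂ _ hpK _ (hdz.trans_le hε₂)⟩,
      fun hzs => hm₃ _ hpK _ (hdz.trans_le hε₃) (subset_closure hzs.2), hring.1, hring.2,
      le_infDist_frontier_of_margin ⟨b, hb⟩ D.isOpen hm₁ hpK (hdz.trans_le hε₁)⟩
  -- the two side potentials along the walk
  have h0T : ∀ y ∈ germSites D b hs' g o δ, 0 ≤ sideSrc (discreteDomainGraph D.carrier δ) D.carrier δ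
      (D.boundary '' Set.Icc σ' θ₁) y := fun _ _ => sideSrc_nonneg
  have h0B : ∀ y ∈ germSites D b hs' g o δ, 0 ≤ sideSrc (discreteDomainGraph D.carrier δ) D.carrier δ
      (D.boundary '' Set.Icc θ₂ τ') y := fun _ _ => sideSrc_nonneg
  have hstart := hTδ u (hsite u π.start_mem_support).1 (by
    calc dist (meshPoint δ u) (D.boundary φ₁)
        ≤ dist (meshPoint δ u) (γ 0) + dist (γ 0) (D.boundary φ₁) := dist_triangle _ _ _
      _ < ε + ρT / 2 := add_lt_add hu hγ0
      _ ≤ ρT := by linarith)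
  have hend := hBδ v (hsite v π.end_mem_support).1 (by
    calc dist (meshPoint δ v) (D.boundary φ₂)
        ≤ dist (meshPoint δ v) (γ 1) + dist (γ 1) (D.boundary φ₂) := dist_triangle _ _ _
      _ < ε + ρB / 2 := add_lt_add hv hγ1
      _ ≤ ρB := by linarith)
  -- ring arithmetic
  have hringΛ : ∀ R : ℝ, t - ε ≤ R → R ≤ t + ε → Λ * s ≤ R ∧ Λ * R ≤ s' := by
    intro R hlo hhi
    have hΛs : 0 < Λ * s := by positivity
    refine ⟨by linarith, ?_⟩
    have hR' : R ≤ 5 / 2 * (Λ * s) := by linarith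
    have h1 : Λ * R ≤ Λ * (5 / 2 * (Λ * s)) := mul_le_mul_of_nonneg_left hR' hΛpos.le
    have h2 : Λ * (5 / 2 * (Λ * s)) ≤ Λ ^ 3 * s := by nlinarith [mul_pos (mul_pos hΛpos hΛpos) hs]
    linarith
  have hsum : ∀ z ∈ π.support, (1 : ℝ) / 2 ≤
      killedPotential (discreteDomainGraph D.carrier δ) (germSites D b hs' g o δ)
          (sideSrc (discreteDomainGraph D.carrier δ) D.carrier δ (D.boundary '' Set.Icc σ' θ₁)) z +
        killedPotential (discreteDomainGraph D.carrier δ) (germSites D b hs' g o δ)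
          (sideSrc (discreteDomainGraph D.carrier δ) D.carrier δ (D.boundary '' Set.Icc θ₂ τ')) z := by
    intro z hz
    obtain ⟨hzΘ', hzΘ, hlo, hhi, -⟩ := hsite z hz
    obtain ⟨hΛsR, hΛRs'⟩ := hringΛ _ hlo hhi
    have hR0 : 0 ≤ max |(meshPoint δ z).re - b.re| |(meshPoint δ z).im - b.im| :=
      (abs_nonneg _).trans (le_max_left _ _)
    have h := hRδ z hzΘ' hzΘ ((mul_le_mul_of_nonneg_right hΛ₀Λ hs.le).trans hΛsR)
      ((mul_le_mul_of_nonneg_right hΛ₀Λ hR0).trans hΛRs')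
    linarith
  obtain ⟨z, hz, hzT, hzB⟩ := exists_hub_vertex_zd (discreteDomainGraph D.carrier δ)
    (germSites D b hs' g o δ) _ _ (1 / 2)
    ((discreteDomainGraph_le_meshGraph _ _).trans (meshGraph_le_zdGraph _ _)) (by norm_num)
    (fun z => killedPotential_nonneg h0T z) (fun z => killedPotential_nonneg h0B z)
    (killedPotential_superharmonicOn h0T) (killedPotential_superharmonicOn h0B) π
    (fun z hz => (hsite z hz).1) (by linarith) (by linarith) hsum
  obtain ⟨hzΘ', hzΘ, hlo, hhi, hρ⟩ := hsite z hz
  obtain ⟨hΛsR, hΛRs'⟩ := hringΛ _ hlo hhi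
  exact ⟨z, hzΘ', hzΘ, hΛsR, hΛRs', hρ, by linarith, by linarith⟩

end Summit.CriticalPhenomena.SAWScalingLimit.Theorems.AvoidanceLimit.Anchor

end
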